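import Summits.QuantumFields.YangMills.Theorems.ContinuumLimitExists.Negative.OvercooledCanonicalScheme

/-!
# `ContinuumLimitExists` — negative side III: the over-cooled canonical scheme satisfies `UUVB`

Tightness certificate, part III, for crux `stmt-QuantumFields-16124`
(`Summit.QuantumFields.YangMills.Theses.OneCertifiedCube.ContinuumLimitExists`), line `birth`, lead
prover `prover-line-stmt-QuantumFields-16124-0`, cycle 2 (2026-08-17).

`UUVB r sch` (uniform-threshold E0'-type bounds for ALL plaquette strings, DefsC) asks for ONE Schwartz
index `s`, constants `α, β` and ONE threshold in `k` beyond which, for EVERY arity `p`, every string of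
single-plaquette species and every off-diagonal test function, `‖canonDistribution k p σ F‖ ≤ α (p!)^β |F|_{p s}`.
The over-cooled canonical scheme of part II meets it with `s = 0`, `α = 1`, `β = 18` and threshold
`k ≥ 972 N` (`uuvb_overcooled`): arities `1 ≤ p ≤ k` are small by construction (`≤ |F|₀/(k+1)`), arity `0`
is an evaluation, and arities `p > k` are handled by the CRUDE bound
`((2L_k+1)⁴)^p (12N)^p |F|₀ ≤ (972 N p⁸)^p |F|₀ ≤ (p⁹)^p |F|₀ ≤ (p!)^{18} |F|₀` (`p ≥ 972 N`, and
`p^p ≤ (p!)²`, `pow_self_le_factorial_sq`). Off-diagonality and smoothness of `F` are never used.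

Final statement `exists_degenerate_scheme_uuvb`: for every compact `G` with a faithful unitary lattice
representation `r` some scheme satisfies
`HasWeakCouplingLimit ∧ PolyVolumeGrowth ∧ ConvProducts ∧ UUVB ∧ Rot345 ∧ CoreClustering ∧ ¬ND2 ∧ ¬ND3` —
the body of the registered `∃`-stub `stub_uvScheme` of line `birth` with its two non-degeneracy clauses
NEGATED, together with the conclusions of both registered `∀`-stubs: `ND2 ∧ ND3` (jointly with convergence)
is the unique load-bearing part of the line. No `sorry`; axioms `propext`, `Classical.choice`, `Quot.sound`.
-/

noncomputable section

open scoped SchwartzMap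
open Filter Topology MeasureTheory Finset
open Literature.MathematicalPhysics.QuantumFieldTheory Literature.MathematicalPhysics.QuantumLattice
open Literature.MathematicalPhysics.AQFT Literature.Probability.LatticeModels
open Summit.QuantumFields.YangMills.Cruxes.ContinuumLimitOnTrajectory.TwoOrbitSynchronisation
open Summit.QuantumFields.YangMills.Theorems.TunedSequenceExists.Negative.Freezing

namespace Summit.QuantumFields.YangMills.Theorems.ContinuumLimitExists.Negative

variable {G : Type} [Group G] [TopologicalSpace G] [IsTopologicalGroup G] [CompactSpace G]
  [MeasurableSpace G] [BorelSpace G]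

/-! ## §1 Elementary: `p^p ≤ (p!)²` -/

/-- `p^p ≤ (p!)²`: pair the factor `i+1` of `p!` with the factor `p-i` of `p!`; each product
`(i+1)(p-i) = p + i(p-1-i)` is at least `p`. -/
theorem pow_self_le_factorial_sq (p : ℕ) : p ^ p ≤ (p.factorial) ^ 2 := by
  have h1 : (∏ i ∈ range p, (i + 1)) = p.factorial := Finset.prod_range_add_one_eq_factorial p
  have h2 : (∏ i ∈ range p, (p - i)) = p.factorial := by
    rw [← Finset.prod_range_reflect, ← h1]
    refine Finset.prod_congr rfl fun i hi => ?_
    rw [Finset.mem_range] at hi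
    omega
  calc p ^ p = ∏ _i ∈ range p, p := by rw [Finset.prod_const, Finset.card_range]
    _ ≤ ∏ i ∈ range p, ((i + 1) * (p - i)) := by
        refine Finset.prod_le_prod' fun i hi => ?_
        rw [Finset.mem_range] at hi
        obtain ⟨d, rfl⟩ := Nat.exists_eq_add_of_lt hi
        have : i + d + 1 - i = d + 1 := by omega
        rw [this]
        nlinarith
    _ = (p.factorial) ^ 2 := by rw [Finset.prod_mul_distrib, h1, h2, sq]

/-! ## §2 The crude bound (all arities, all levels) -/

/-- The arity-`0` centred moment is `1` (probability measure, empty product). -/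
theorem centredMoment_zero (r : LatticeRep G) (L : ℕ) (β : ℝ) (τ : Fin 0 → Option PlaqIdx)
    (x : Fin 0 → Site 4) : centredMoment r L β 0 τ x = 1 := by
  haveI : IsProbabilityMeasure (wilsonMeasure (d := 4) (L := 2 * L + 1) (G := G) r.ρ β) :=
    isProbabilityMeasure_wilsonMeasure r.ρ r.continuous β
  simp [centredMoment]

/-- **Crude bound on centred moments**: `|centredMoment| ≤ (12N)^p` (each centred factor is at most
`6N + 6N`). -/
theorem abs_centredMoment_le (r : LatticeRep G) (L : ℕ) (β : ℝ) (p : ℕ) (τ : Fin p → Option PlaqIdx)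
    (x : Fin p → Site 4) : |centredMoment r L β p τ x| ≤ (12 * (r.N : ℝ)) ^ p := by
  haveI : IsProbabilityMeasure (wilsonMeasure (d := 4) (L := 2 * L + 1) (G := G) r.ρ β) :=
    isProbabilityMeasure_wilsonMeasure r.ρ r.continuous β
  unfold centredMoment
  have hfac : ∀ (U : GaugeConfig 4 (2 * L + 1) G) (i : Fin p),
      |(obsOf r (τ i)).F (configShift (-(x i)) (torusLift (2 * L + 1) U)) -
        wilsonTorusMean r.ρ β L (obsOf r (τ i)).F| ≤ 12 * (r.N : ℝ) := fun U i => by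
    have h1 := abs_obsOf_le r (τ i) (configShift (-(x i)) (torusLift (2 * L + 1) U))
    have h2 := abs_wilsonTorusMean_obsOf_le r β L (τ i)
    exact (abs_sub _ _).trans (by linarith)
  have hptw : ∀ U : GaugeConfig 4 (2 * L + 1) G,
      |∏ i, ((obsOf r (τ i)).F (configShift (-(x i)) (torusLift (2 * L + 1) U)) -
        wilsonTorusMean r.ρ β L (obsOf r (τ i)).F)| ≤ (12 * (r.N : ℝ)) ^ p := fun U => by
    rw [Finset.abs_prod]
    refine (Finset.prod_le_prod (fun i _ => abs_nonneg _) fun i _ => hfac U i).trans ?_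
    rw [Finset.prod_const, Finset.card_univ, Fintype.card_fin]
  calc |∫ U, ∏ i, ((obsOf r (τ i)).F (configShift (-(x i)) (torusLift (2 * L + 1) U)) -
          wilsonTorusMean r.ρ β L (obsOf r (τ i)).F) ∂(wilsonMeasure r.ρ β)|
      ≤ ∫ U, |∏ i, ((obsOf r (τ i)).F (configShift (-(x i)) (torusLift (2 * L + 1) U)) -
          wilsonTorusMean r.ρ β L (obsOf r (τ i)).F)| ∂(wilsonMeasure r.ρ β) := abs_integral_le_integral_abs
    _ ≤ ∫ _U, (12 * (r.N : ℝ)) ^ p ∂(wilsonMeasure (d := 4) (L := 2 * L + 1) r.ρ β) :=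
        integral_mono_of_nonneg (ae_of_all _ fun U => abs_nonneg _) (integrable_const _) (ae_of_all _ hptw)
    _ = (12 * (r.N : ℝ)) ^ p := by rw [integral_const]; simp

/-- **Crude bound on canonical distributions** (all `p`, all `k`):
`‖canonDistribution k p σ F‖ ≤ ((2L_k+1)⁴)^p (12N)^p |F|₀`. -/
theorem norm_canonDistribution_obsOf_crude (r : LatticeRep G) (sch : SpeciesScheme (YMSpecies G)) (k p : ℕ)
    (τ : Fin p → Option PlaqIdx) (F : 𝓢((Fin p → EuclideanSpace ℝ (Fin 4)), ℂ)) :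
    ‖canonDistribution r sch k p (fun i => obsOf r (τ i)) F‖ ≤
      ((2 * (sch.L k : ℝ) + 1) ^ 4) ^ p * schwartzNorm 0 F * (12 * (r.N : ℝ)) ^ p :=
  norm_canonDistribution_obsOf_le r sch k p τ F fun _ => abs_centredMoment_le r _ _ p τ _

/-- The arity-`0` canonical distribution is bounded by `|F|₀` (it is an evaluation). -/
theorem norm_canonDistribution_obsOf_zero_le (r : LatticeRep G) (sch : SpeciesScheme (YMSpecies G)) (k : ℕ)
    (τ : Fin 0 → Option PlaqIdx) (F : 𝓢((Fin 0 → EuclideanSpace ℝ (Fin 4)), ℂ)) :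
    ‖canonDistribution r sch k 0 (fun i => obsOf r (τ i)) F‖ ≤ schwartzNorm 0 F := by
  have h := norm_canonDistribution_obsOf_le r sch k 0 τ F (ε := 1) fun _ => by
    rw [centredMoment_zero]; simp
  simpa using h

/-! ## §3 `UUVB` for the over-cooled scheme -/

/-- The geometric input: for `k + 1 ≤ p`, `(2L_k+1)⁴ ≤ 81 p⁸`. -/
theorem side_pow_four_le (k p : ℕ) (hkp : k + 1 ≤ p) :
    (2 * (ocL k : ℝ) + 1) ^ 4 ≤ 81 * (p : ℝ) ^ 8 := by
  have hp : ((k : ℝ) + 1) ≤ p := by exact_mod_cast hkp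
  have hk0 : (0 : ℝ) ≤ (k : ℝ) + 1 := by positivity
  have h1 : (2 * (ocL k : ℝ) + 1) ≤ 3 * (p : ℝ) ^ 2 := by
    unfold ocL; push_cast
    nlinarith [mul_le_mul hp hp hk0 ((Nat.cast_nonneg k).trans (by linarith))]
  have h0 : (0 : ℝ) ≤ 2 * (ocL k : ℝ) + 1 := by positivity
  calc (2 * (ocL k : ℝ) + 1) ^ 4 ≤ (3 * (p : ℝ) ^ 2) ^ 4 := pow_le_pow_left₀ h0 h1 4
    _ = 81 * (p : ℝ) ^ 8 := by ring

/-- The arithmetic input: for `972 N ≤ p`, `(81 p⁸)^p (12N)^p ≤ (p!)^18`. -/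
theorem crude_le_factorial_pow (N p : ℕ) (hp : 972 * N ≤ p) (hp1 : 1 ≤ p) :
    (81 * (p : ℝ) ^ 8) ^ p * (12 * (N : ℝ)) ^ p ≤ ((p.factorial : ℝ)) ^ (18 : ℕ) := by
  have hN : (972 : ℝ) * N ≤ p := by exact_mod_cast hp
  have hp0 : (0 : ℝ) ≤ (p : ℝ) := Nat.cast_nonneg p
  -- `(81 p⁸)(12 N) = 972 N p⁸ ≤ p⁹`
  have hstep : 81 * (p : ℝ) ^ 8 * (12 * (N : ℝ)) ≤ (p : ℝ) ^ 9 := by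
    have : 81 * (p : ℝ) ^ 8 * (12 * (N : ℝ)) = (972 * (N : ℝ)) * (p : ℝ) ^ 8 := by ring
    rw [this, show (p : ℝ) ^ 9 = (p : ℝ) * (p : ℝ) ^ 8 by ring]
    exact mul_le_mul_of_nonneg_right hN (by positivity)
  -- `p^p ≤ (p!)²` in `ℝ`
  have hfac : ((p : ℝ) ^ 9) ^ p ≤ ((p.factorial : ℝ)) ^ (18 : ℕ) := by
    have hnat : (p ^ p : ℝ) ≤ ((p.factorial : ℝ)) ^ 2 := by exact_mod_cast pow_self_le_factorial_sq p
    calc ((p : ℝ) ^ 9) ^ p = ((p : ℝ) ^ p) ^ 9 := by rw [← pow_mul, ← pow_mul, mul_comm]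
      _ ≤ (((p.factorial : ℝ)) ^ 2) ^ 9 := pow_le_pow_left₀ (by positivity) hnat 9
      _ = ((p.factorial : ℝ)) ^ (18 : ℕ) := by rw [← pow_mul]
  calc (81 * (p : ℝ) ^ 8) ^ p * (12 * (N : ℝ)) ^ p = (81 * (p : ℝ) ^ 8 * (12 * (N : ℝ))) ^ p := by
        rw [← mul_pow]
    _ ≤ ((p : ℝ) ^ 9) ^ p := pow_le_pow_left₀ (by positivity) hstep p
    _ ≤ ((p.factorial : ℝ)) ^ (18 : ℕ) := hfac

/-- **`UUVB` holds for the over-cooled scheme** with `s = 0`, `α = 1`, `β = 18`, threshold `k ≥ 972 N`. -/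
theorem uuvb_overcooled (r : LatticeRep G) : UUVB r (overcooled r) := by
  refine ⟨0, 1, 18, ?_⟩
  filter_upwards [eventually_ge_atTop (972 * r.N)] with k hk p q F _
  rw [one_mul, Nat.mul_zero]
  have hfac1 : (1 : ℝ) ≤ ((p.factorial : ℝ)) ^ (18 : ℝ) := by
    have h1 : (1 : ℝ) ≤ (p.factorial : ℝ) := by exact_mod_cast Nat.one_le_iff_ne_zero.2 p.factorial_ne_zero
    exact Real.one_le_rpow h1 (by norm_num)
  have hN := schwartzNorm_nonneg 0 F
  -- rewrite the real power `(p!)^(18:ℝ)` as a natural power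
  have hrpow : ((p.factorial : ℝ)) ^ (18 : ℝ) = ((p.factorial : ℝ)) ^ (18 : ℕ) := by
    rw [← Real.rpow_natCast]; norm_num
  -- the string `plaq r ∘ q` is the alphabet string `some ∘ q`
  have hσ : (fun i => plaq r (q i)) = fun i => obsOf r (some (q i)) := rfl
  rw [hσ]
  rcases Nat.lt_or_ge k p with hkp | hpk
  · -- large arity `p > k ≥ 972 N`: crude bound against the factorial
    have hp1 : 1 ≤ p := by omega
    refine (norm_canonDistribution_obsOf_crude r (overcooled r) k p _ F).trans ?_
    rw [overcooled_L, hrpow]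
    have hside := side_pow_four_le k p hkp
    have h0 : (0 : ℝ) ≤ (2 * (ocL k : ℝ) + 1) ^ 4 := by positivity
    calc ((2 * (ocL k : ℝ) + 1) ^ 4) ^ p * schwartzNorm 0 F * (12 * (r.N : ℝ)) ^ p
        = (((2 * (ocL k : ℝ) + 1) ^ 4) ^ p * (12 * (r.N : ℝ)) ^ p) * schwartzNorm 0 F := by ring
      _ ≤ ((81 * (p : ℝ) ^ 8) ^ p * (12 * (r.N : ℝ)) ^ p) * schwartzNorm 0 F := by
          refine mul_le_mul_of_nonneg_right ?_ hN
          exact mul_le_mul_of_nonneg_right (pow_le_pow_left₀ h0 hside p) (by positivity)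
      _ ≤ ((p.factorial : ℝ)) ^ (18 : ℕ) * schwartzNorm 0 F :=
          mul_le_mul_of_nonneg_right (crude_le_factorial_pow r.N p (by omega) hp1) hN
  · -- small arity `p ≤ k`: evaluation (`p = 0`) or smallness (`1 ≤ p ≤ k`)
    have hle : ‖canonDistribution r (overcooled r) k p (fun i => obsOf r (some (q i))) F‖ ≤ schwartzNorm 0 F := by
      rcases Nat.eq_zero_or_pos p with rfl | hp
      · exact norm_canonDistribution_obsOf_zero_le r (overcooled r) k _ F
      · refine (norm_canonDistribution_overcooled_le r hp hpk _ F).trans ?_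
        have hk1 : (1 : ℝ) ≤ (k : ℝ) + 1 := by
          have : (0 : ℝ) ≤ k := Nat.cast_nonneg k
          linarith
        exact div_le_self hN hk1
    calc ‖canonDistribution r (overcooled r) k p (fun i => obsOf r (some (q i))) F‖
        ≤ schwartzNorm 0 F := hle
      _ = 1 * schwartzNorm 0 F := (one_mul _).symm
      _ ≤ ((p.factorial : ℝ)) ^ (18 : ℝ) * schwartzNorm 0 F := mul_le_mul_of_nonneg_right hfac1 hN

/-- **Tightness of the `∃`-stub of line `birth` (final form).** For every compact `G` admitting a
faithful unitary lattice representation `r` there is a scheme with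
`HasWeakCouplingLimit ∧ PolyVolumeGrowth ∧ ConvProducts ∧ UUVB ∧ Rot345 ∧ CoreClustering` — every
hypothesis-side conjunct of `stub_uvScheme` and both `∀`-stub conclusions — which violates `ND2` and
`ND3`. -/
theorem exists_degenerate_scheme_uuvb (r : LatticeRep G) :
    ∃ sch : SpeciesScheme (YMSpecies G), sch.HasWeakCouplingLimit ∧ PolyVolumeGrowth sch ∧
      ConvProducts r sch ∧ UUVB r sch ∧ Rot345 r sch ∧ CoreClustering r sch ∧ ¬ ND2 r sch ∧ ¬ ND3 r sch :=
  ⟨overcooled r, hasWeakCouplingLimit_overcooled r, polyVolumeGrowth_overcooled r, convProducts_overcooled r,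
    uuvb_overcooled r, rot345_overcooled r, coreClustering_overcooled r, not_ND2_overcooled r,
    not_ND3_overcooled r⟩

end Summit.QuantumFields.YangMills.Theorems.ContinuumLimitExists.Negative

end
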